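import Summits.HodgeConjecture.HodgeConjecture.Theorems.VHCAbelianSchemesRoadTwistJetPushforwardCompat
import Summits.HodgeConjecture.HodgeConjecture.Theorems.VHCAbelianSchemesRoadIsogenyTwistPushforwardIso
import Summits.HodgeConjecture.HodgeConjecture.Theorems.VHCAbelianSchemesRoadAtiyahPushforwardCompatOfJets
import Summits.HodgeConjecture.HodgeConjecture.Theorems.VHCAbelianSchemesRoadIsogenyDerivedAdjointPairOfRouteKDelta
import Summits.HodgeConjecture.HodgeConjecture.Theorems.VHCAbelianSchemesRoadIsogenyTwistIotaCompat
import HarnessLib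

/-!
# Road №4 (`VHCAbelianSchemesRoad`) — the twisted-jet comparison and the `ι•`-compatibility for core-w6's isogeny twist
# comparison `α₀ = isogenyTwistPushforwardIsoFamily hΩ` (module half of input (At) of crux stmt-HodgeConjecture-26512);
# the registered stub (c1At) `stub_atiyahPair` CLOSED MODULO ONE module-level identity (W) of `α₀`

research route conditional on HC_CM; not a corollary; Q11.4-sentence-2 already refuted in dim ≥ 3.

Seat core-qb (director-hodge g16 R16.18 (1) ∕ R16.20 (6) ∕ R16.22: (c1At) = core-w3's derived half + this module half). For an isogeny `g`
of a complex abelian variety `A` and core-w6's twist comparison `α_q(g)(E) : g_*(E ⊗ Ω^q) ≅ (g_*E) ⊗ Ω^q` (p650171,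
`isogenyTwistHodgePushforwardIso hΩ A g hg q E hE`, finite locally free `E`; complexes: `isogenyTwistPushforwardIsoFamily hΩ`):

* `IsogenyTwistWedgeDCompat hΩ` — the ONE DISPLAYED INPUT (W): `α_{j+1}(D(g♯a, φ)) = D(a, α_j φ)` (the twisting terms `da ∧ –`
  correspond under `α₀`; core-w6's announced consequence of the generator formula for `α₀`; not in the tree at the time of writing);
* `isogenyTwistPushforwardCompat hW A g hg : TwistPushforwardCompat g.hom.hom.hom IsFiniteLocallyFree` — (W) + the LANDED naturality (N)
  `isogenyTwistHodgePushforwardIso_naturality` packaged for the generic machine of `Theorems/VHCAbelianSchemesRoadTwistJetPushforwardCompat`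
  (p651635);
* **`twistJetPushforwardComparison_isogenyTwist`** — GIVEN (W): core-w3's displayed predicate `TwistJetPushforwardComparison (α₀ hΩ A g hg)`
  (p652793) BY NAME (a morphism of termwise twisted Atiyah sequences `(T_j K).map g_*• ⟶ T_j (g_*•K)` with outer components `α₀`);
* **`iotaPushforwardCompat_isogenyTwist`** — core-w3's displayed predicate `IotaPushforwardCompat (α₀ hΩ A g hg)` BY NAME, now a THEOREM
  outright: termwise it is core-w6's landed `map_toTwistHodgeZero_comp_isogenyTwistHodgePushforwardIso` (p653206);
* **`atiyahClassPushforwardCompatPair_routeK_of_wedgeD : IsogenyTwistWedgeDCompat hΩ → AtiyahClassPushforwardCompatPair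
  isogenyDerivedAdjointPairOfRouteK (isogenyTwistPushforwardIsoFamily hΩ)`** — the registered stub (c1At) `stub_atiyahPair hΩ`'s statement
  (skeleton v3.13, `Cruxes/DiagLocalOfMarkmanPinnedForall/Lines/birth.lean` :279) from (W) ALONE: core-w3's reduction
  `atiyahClassPushforwardCompatPair_of` fed with the node law (δ) for `P₀` (core-w5's `adjTriangleOfSESδComp_isogenyDerivedAdjointPairOfRouteK_all`,
  p653329, a theorem) and the two predicates above.

Nothing here says (W), (c1At), (At), (SC), T′, (c1), HC_AV or HC holds; (W) is a hypothesis displayed by name; `hΩ`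
(`Mumford1970_cotangentSheaf_abelianVariety_free`, the registered stub (c1Ω)) is the road's named-fact input of `α₀`, used in hypothesis form
exactly as in p650171 and NOT concluded anywhere here; HC_CM untouched. `--supports stmt-HodgeConjecture-26512 --as helper`; closes no stub.

References: R.-O. Buchweitz, H. Flenner, Compositio Math. 137 (2003), §3, Def. 4.1 [BuchweitzFlenner2003]; M. F. Atiyah, Trans. AMS 85 (1957),
§4 Prop. 6–7 [Atiyah1957]; R. Hartshorne (1977), II Ex. 5.1, II §5 pp. 109–110 [Hartshorne1977]; D. Mumford, *Abelian Varieties*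
(1970), §4 (iii) (p. 42) [MumfordAV1970].
-/

noncomputable section

-- `TopCat.Presheaf`/`Scheme.Modules` are not reducible (as in Mathlib's `AlgebraicGeometry/Modules/Sheaf.lean`).
set_option backward.isDefEq.respectTransparency false
set_option linter.dupNamespace false -- the cell's namespace repeats the summit name, as in every `Ring2*` file

open CategoryTheory CategoryTheory.Category CategoryTheory.Limits AlgebraicGeometry Opposite TopologicalSpace
open AlgebraicGeometry.Scheme.Modules

namespace Summit.HodgeConjecture.HodgeConjecture.Ring2.SemiregularRepresentatives

open Literature.AlgebraicGeometry Literature.AlgebraicGeometry.Modules Literature.AlgebraicGeometry.Motives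
open Literature.AlgebraicGeometry.Motives.AbelianVariety
open Literature.AlgebraicGeometry.HodgeTheory (TwistJetSections twistHodge twistJetModule wedgeD toTwistHodgeZero)
open Summit.Ventures.HSemireg

variable (hΩ : Mumford1970_cotangentSheaf_abelianVariety_free)

/-! ## The displayed module-level input (W) on `α₀` -/

/-- **Input (W) — the twisting terms correspond under `α₀`**: for every isogeny `g`, finite locally free `E`, open `U ⊆ A`,
`a ∈ Γ(U, 𝒪_A)` and `φ ∈ Γ(g⁻¹U, E ⊗ Ωʲ)`, `α_{j+1}(g)(E)(D(g♯a, φ)) = D(a, α_j(g)(E)(φ))` where `D(a, φ) = da ∧ φ` (`wedgeD`).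
Core-w6's announced consequence of the generator formula for `α₀` (after `IsIso (isogenyPullbackForms A g q)`, p652022); IN-HOUSE; NOT
in the tree when this file was written; a HYPOTHESIS wherever used. [cite: BuchweitzFlenner2003, §3 (twisted jet sequences; reading: functoriality along a finite étale map)] -/
@[conjecture] def IsogenyTwistWedgeDCompat : Prop :=
  ∀ (A : AbelianVariety ℂ) (g : A ⟶ A) (hg : IsIsogeny g) ⦃E : A.X.left.Modules⦄ (hE : IsFiniteLocallyFree E) (j : ℕ)
    (U : A.X.left.Opens) (a : Γ(A.X.left, U))
    (φ : (dual E).over (Hom.toSchemeHom g ⁻¹ᵁ U) ⟶ (hodgeSheaf A.X j).over (Hom.toSchemeHom g ⁻¹ᵁ U)),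
    (isogenyTwistHodgePushforwardIso hΩ A g hg (j + 1) E hE).hom.app U
        (wedgeD E j (Hom.toSchemeHom g ⁻¹ᵁ U) ((Hom.toSchemeHom g).app U a) φ) =
      wedgeD ((pushforward (Hom.toSchemeHom g)).obj E) j U a
        ((isogenyTwistHodgePushforwardIso hΩ A g hg j E hE).hom.app U φ)

/-! ## `α₀` as a wedge-compatible natural twist comparison, GIVEN (W) -/

variable {hΩ}

/-- **`α₀` packaged for the generic twisted-jet machine**: data `α_j(g)(E)` (p650171), (W) the displayed input, (N) the LANDED
naturality `isogenyTwistHodgePushforwardIso_naturality`. [cite: BuchweitzFlenner2003, §3 (reading: functoriality along a finite étale map)] -/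
def isogenyTwistPushforwardCompat (hW : IsogenyTwistWedgeDCompat hΩ) (A : AbelianVariety ℂ) (g : A ⟶ A) (hg : IsIsogeny g) :
    TwistPushforwardCompat g.hom.hom.hom (fun E : A.X.left.Modules => IsFiniteLocallyFree E) where
  hom E hE j := (isogenyTwistHodgePushforwardIso hΩ A g hg j E hE).hom
  hom_app_wedgeD E hE j U a φ := by
    -- `g.hom.hom.hom.left = Hom.toSchemeHom g` (reducibly)
    exact hW A g hg hE j U a φ
  naturality E₁ E₂ h₁ h₂ f j := by
    simp only [twistFunctor_map]
    exact isogenyTwistHodgePushforwardIso_naturality hΩ A g hg j h₁ h₂ f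

variable (hW : IsogenyTwistWedgeDCompat hΩ) (A : AbelianVariety ℂ) (g : A ⟶ A) (hg : IsIsogeny g)

/-- The termwise chain map of the package IS core-w6's complex isomorphism `α₀(q)(K•)` (both termwise `α_q(g)(Kⁱ)`). [folklore] -/
theorem complexHom_isogenyTwistPushforwardCompat (j : ℕ) (K : CochainComplex A.X.left.Modules ℤ)
    (hK : ∀ i, IsFiniteLocallyFree (K.X i)) :
    (isogenyTwistPushforwardCompat hW A g hg).complexHom j K hK =
      (isogenyTwistPushforwardIsoFamily hΩ A g hg j K hK).hom :=
  HomologicalComplex.hom_ext _ _ fun _ => rfl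

include hW in
/-- **The twisted-jet comparison for `α₀`, GIVEN (W)** — the morphism of termwise twisted Atiyah sequences
`(T_j K).map g_*• ⟶ T_j(g_*•K)` with outer components `α₀(j+1)(K•)`, `α₀(j)(K•)`. CONDITIONAL on (W) only.
[cite: BuchweitzFlenner2003, §3 (twisted jet sequences; reading: functoriality along a finite étale map)] [cite: Atiyah1957, §4 Prop. 6–7] -/
theorem exists_twistJetComparison_isogenyTwist (j : ℕ) (K : CochainComplex A.X.left.Modules ℤ)
    (hK : ∀ i, IsFiniteLocallyFree (K.X i)) :
    ∃ τ : (twistJetComplexShortComplex A.X j K).map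
          ((pushforward (Hom.toSchemeHom g)).mapHomologicalComplex (ComplexShape.up ℤ)) ⟶
        twistJetComplexShortComplex A.X j (endoPushforwardComplex A g K),
      τ.τ₁ = (isogenyTwistPushforwardIsoFamily hΩ A g hg (j + 1) K hK).hom ∧
        τ.τ₃ = (isogenyTwistPushforwardIsoFamily hΩ A g hg j K hK).hom := by
  refine ⟨(isogenyTwistPushforwardCompat hW A g hg).complexShortComplexHom j K hK, ?_, ?_⟩
  · rw [TwistPushforwardCompat.complexShortComplexHom_τ₁, complexHom_isogenyTwistPushforwardCompat]
  · rw [TwistPushforwardCompat.complexShortComplexHom_τ₃, complexHom_isogenyTwistPushforwardCompat]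

include hW in
/-- **(i-a) for `α₀`, GIVEN (W)**: core-w3's `TwistJetPushforwardComparison (isogenyTwistPushforwardIsoFamily hΩ A g hg)`.
CONDITIONAL on (W). [cite: Atiyah1957, §4 Prop. 6–7] [cite: BuchweitzFlenner2003, §3] -/
theorem twistJetPushforwardComparison_isogenyTwist :
    TwistJetPushforwardComparison (isogenyTwistPushforwardIsoFamily hΩ A g hg) :=
  fun K hK j => exists_twistJetComparison_isogenyTwist hW A g hg j K hK

/-! ## The `ι•`-compatibility for `α₀` — a THEOREM (termwise core-w6's p653206) -/

variable (hΩ) in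
/-- **The `ι•`-compatibility for `α₀`**: `g_*•(ι•_K) ≫ α₀(0)(K•) = ι•_{g_*•K}` for every complex `K` with finite locally free terms —
termwise core-w6's `map_toTwistHodgeZero_comp_isogenyTwistHodgePushforwardIso` (`g_*(ι_E) ≫ α_0 = ι_{g_*E}`). Unconditional given `hΩ`.
[cite: Hartshorne1977, II Ex. 5.1 (a), (b) (reading: along a finite étale map)] -/
theorem map_toTwistHodgeZeroC_comp_isogenyTwist (K : CochainComplex A.X.left.Modules ℤ)
    (hK : ∀ i, IsFiniteLocallyFree (K.X i)) :
    ((pushforward (Hom.toSchemeHom g)).mapHomologicalComplex (ComplexShape.up ℤ)).map (toTwistHodgeZeroC A.X K) ≫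
        (isogenyTwistPushforwardIsoFamily hΩ A g hg 0 K hK).hom =
      toTwistHodgeZeroC A.X (endoPushforwardComplex A g K) := by
  refine HomologicalComplex.hom_ext _ _ fun i => ?_
  rw [HomologicalComplex.comp_f, Functor.mapHomologicalComplex_map_f, toTwistHodgeZeroC_f, toTwistHodgeZeroC_f]
  exact map_toTwistHodgeZero_comp_isogenyTwistHodgePushforwardIso hΩ A g hg (K.X i) (hK i)

variable (hΩ) in
/-- **(i-b) for `α₀` — PROVED**: core-w3's displayed predicate `IotaPushforwardCompat (isogenyTwistPushforwardIsoFamily hΩ A g hg)` holds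
for every isogeny (termwise core-w6's p653206). [cite: Hartshorne1977, II Ex. 5.1 (a), (b)] [cite: BuchweitzFlenner2003, Def. 4.1] -/
theorem iotaPushforwardCompat_isogenyTwist :
    IotaPushforwardCompat (isogenyTwistPushforwardIsoFamily hΩ A g hg) :=
  fun K hK => map_toTwistHodgeZeroC_comp_isogenyTwist hΩ A g hg K hK

/-! ## The residual form of the registered stub (c1At) -/

variable (hΩ) in
/-- **(c1At) RESIDUAL — the registered stub `stub_atiyahPair hΩ`'s statement from the ONE named input (W)**: core-w3's reduction
`atiyahClassPushforwardCompatPair_of` (p652793) over the route-K pair `P₀ = isogenyDerivedAdjointPairOfRouteK` (core-w7, p652104), fed with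
the node law (δ) (core-w5's THEOREM `adjTriangleOfSESδComp_isogenyDerivedAdjointPairOfRouteK_all`, p653329), the twisted-jet comparison (i-a)
(this file, from (W)) and the `ι•`-compatibility (i-b) (this file, a theorem). CONDITIONAL on (W) = `IsogenyTwistWedgeDCompat hΩ` only;
closes no stub; HC_CM untouched. [cite: BuchweitzFlenner2003, §3 and Def. 4.1] [cite: Atiyah1957, §4 Prop. 6–7] -/
theorem atiyahClassPushforwardCompatPair_routeK_of_wedgeD (hW : IsogenyTwistWedgeDCompat hΩ) :
    AtiyahClassPushforwardCompatPair isogenyDerivedAdjointPairOfRouteK (isogenyTwistPushforwardIsoFamily hΩ) :=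
  atiyahClassPushforwardCompatPair_of isogenyDerivedAdjointPairOfRouteK (isogenyTwistPushforwardIsoFamily hΩ)
    adjTriangleOfSESδComp_isogenyDerivedAdjointPairOfRouteK_all
    (twistJetPushforwardComparison_isogenyTwist hW) (iotaPushforwardCompat_isogenyTwist hΩ)

end Summit.HodgeConjecture.HodgeConjecture.Ring2.SemiregularRepresentatives

end
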